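import Literature.MathematicalPhysics.QuantumFieldTheory.Balaban1983to89.B9Eq3134MatrixConcrete
import Literature.MathematicalPhysics.QuantumFieldTheory.Balaban1983to89.B9SectDSup

/-!
# `Balaban1983to89.B9Eq3138StepDelta2Pi` — T. Bałaban, *Propagators for lattice gauge theories in a background field*, Commun. Math. Phys.
**99** (1985) 389–434 [Balaban1985BackgroundPropagators], Sect. D, (3.135) p. 422 and (3.138) p. 423: THE `Δ⁽²⁾_π` SUMMAND OF THE
PERTURBATION STEP `G₀(Δ′_π + Δ⁽²⁾_π)` OF (3.138), FACTORED AS PRINT ESTIMATES IT — «derivatives in the operator Δ′_π + Δ⁽²⁾_π … have to be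
applied either to the operator on the right, or on the left»: `G₀Δ⁽²⁾_π = G₀·[Δ⁽²⁾T] − (G₀D)·[RG′D*Δ⁽²⁾T]` (`T = 1 − DG′RD*`, the outer `D` of
the dressing `DRG′D*` absorbed into the neighbouring `G₀`), i.e. `G₀Δ⁽²⁾_π = 𝒢 ∘ 𝒯₂` through the auxiliary space of pairs (bond configuration,
site function) of the pub-balaban Sect.-D bookkeeping `B9SectDSup` (`𝒢(φ,ψ) = G₀φ + G₀Dψ`), with the majorant of `𝒯₂` from the letters `T`,
`RG′D*` and a majorant of `Δ⁽²⁾` — CONCRETE for [5]'s realised `Δ⁽²⁾ = delta2 calC` (FILE 74) — and the right entries of `G₁` by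
`B9SectDSup.rightEntry_of_factored`; FILE 78 of the Sect. B–D programme of cell `lit-balaban`, seat r06 (B9 fold owner); rows **B9.Eq3.134**
((3.135)), **B9.Eq3.138**, **B9.Thm3.12** (member cells; heads are the lead's word)

statement-level skeleton of published theorems with citation tags; proofs where landed; nothing here is a claim about the Yang–Mills mass gap

CITATION HEADER (lean-in-tree rule).  B9 = [Balaban1985BackgroundPropagators] (held `paper:balaban1985-cmp99-background-propagators`, journal
page = PDF page + 388; renders `…-p034-x2.png`, `…-p035-x2.png` read as images by this seat 2026-08-24).  p. 422 [PDF 34]: «A meaning of Δ⁽²⁾_π is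
obvious, it defines the second quadratic form in (3.128), i.e. we have Δ⁽²⁾_π = Δ⁽²⁾ − DRG′D\*Δ⁽²⁾ − Δ⁽²⁾DG′RD\* + DRG′D\*Δ⁽²⁾DG′RD\*. (3.135)»;
p. 423 [PDF 35]: «This bound implies that the operators Δ⁽²⁾, Δ⁽²⁾_π are small in a proper sense, if α₀ is sufficiently small. Similarly as in
(3.130) we get G₁ = G₀(I − (Δ′_π + Δ⁽²⁾_π)G₀)⁻¹ = Σ_{n=0}^∞ G₀((Δ′_π + Δ⁽²⁾_π)G₀)ⁿ. (3.138) Estimates of the terms in this series are now a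
little bit more complicated. It is connected with the fact that we have derivatives in the operator Δ′_π + Δ⁽²⁾_π which have to be applied
either to the operator on the right, or on the left, because kernels of the operators defining Δ_π + Δ⁽²⁾_π are not regular enough.
‖ζ∇G₀DRG′D\*Δ⁽²⁾Δ(y′)A‖_β ≦ … This estimate is given for first factors in a term, the remaining factors are easier to estimate, following the
above pattern. … the series (3.138) is convergent for α₀ restricted by a small, absolute constant. The convergence is in all norms appearing in
the formulation of Theorem 3.3. This implies that the theorem is valid for G₁.»  [4] = [Balaban1984PropagatorsII] (2.52)–(2.55) p. 232, Lemma 2.1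
(2.61) p. 234.

WHAT IS PROVED (kernel; theorems only — 0 `def`, 0 named fact, 0 sorry).  Carriers: p10's Sect.-D matrix vocabulary (`B9SectDFP`/`B9Delta2Def134`:
bond index type `X`, site index type `n`, `T = tOp Δ Q a D = 1 − DG′RD*`, `Δ⁽²⁾_π = delta2pi 𝒞 Δ Q a D = TᵀΔ⁽²⁾T`, `Δ⁽²⁾ = delta2 𝒞`), r16's
block norms (`B11SectG`) and the product norm of `B9SectDSup`.
* §1 THE FACTORISATION (matrix algebra, `Δ` symmetric so that `Tᵀ = 1 − DRG′D*`, p10's `tOp_transpose`): `mul_piOp_eq` — `G₀·(TᵀKT) = G₀·(KT) −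
  (G₀D)·(RG′D*KT)` for ANY `G₀`, `K`; **`mulVecLin_mul_delta2pi`** — as linear maps `G₀Δ⁽²⁾_π = 𝒢 ∘ 𝒯₂` with `𝒢 := G₀ ⊕ G₀D` (`LinearMap.coprod`)
  and `𝒯₂ := (Δ⁽²⁾T, −RG′D*Δ⁽²⁾T)` (`LinearMap.prod`) — the shape `B9SectDSup.factored_rightEntry_fix` consumes.
* §2 THE MAJORANT OF `𝒯₂` FROM THE LETTERS ([4] (2.52)–(2.55), any block norms `bC` (state), `bA` (sup-type) on `X → ℝ`, `bP` on `n → ℝ`):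
  **`hasMaj_T2`** — `T : bC → bA` with `C_Te^{−δ₁d}`, `Δ⁽²⁾ : bA → bA` with `θe^{−δ₁d}`, `RG′D* : bA → bP` with `B₁e^{−δ₁d}` ⟹ `𝒯₂ : bC → bA × bP`
  (`B9SectDSup.prodNorm`) has `κ_Aθ C_T c(1 + κ_A B₁ c)·e^{−ρd}`, `ρ + 2σ ≦ δ₁`; `hasMaj_G` — `𝒢 : bA × bP → bC` from the two `G₀`-letters
  (`G₀ : bA → bC`, `G₀D : bP → bC`; Theorem 3.3 (3.42)₁/(3.43)₁ and (3.42)₃/(3.43)₂/(3.45)) by `B9SectDSup.hasMaj_coprod_exp`.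
* §3 **`rightEntry_G1_factored`** — (3.138) FOR THE RIGHT ENTRIES `G₁F` IN THE FACTORED FORM: given the step identity for the `Δ′_π` summand as
  a letter (`G₀Δ′_π = 𝒢 ∘ 𝒯₁`, md Lemma 4.2 of `B9SectDSup`, hypothesis `hT1`) and §1 for `Δ⁽²⁾_π`, the resolvent form `G₁ = G₀ + G₀(Δ′_π +
  Δ⁽²⁾_π)G₁` of (3.138) IS `G₁ = G₀ + 𝒢(𝒯₁ + 𝒯₂)G₁`, whence `B9SectDSup.rightEntry_of_factored`: `G₁F` has `A(1 − q)⁻¹e^{−ρd}`,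
  `q = κ_C(κ_{A×P}B_𝒢(C₁ + C₂)c)c < 1` («α₀ restricted by a small, absolute constant»).
  `entry_G1_factored` — the two-sided entries `EG₁F` likewise (`B9SectDSup.entry_majorant`); **`rightEntry_G1_small`** — «for α₀ restricted by
  a small, absolute constant» LOCATED: step constants linear in `m = Mα₀`, `m ≦ (2D)⁻¹` ⟹ `q ≦ ½` ⟹ right entries `2A·e^{−ρd}`.
* §4 **`hasMaj_T2_concrete`** — §2 with `Δ⁽²⁾ = delta2 (calC …)` of FILE 74 on the sharp-block sup sizes `BlockNorm.ofBlocks g blk` of the real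
  coordinates `S × ι → ℝ` (`B9Eq3134MatrixConcrete.hasMaj_delta2_calC_exp`: `θ = θ_Δe^{δ₁R}`, `θ_Δ = [2dC₃‖τ‖(Σ_i‖e_i‖)M_e c₀·#lv]·(Mα₀)` —
  `O(1)·Mα₀`, regime of `B7Eq136SecondOrder` verbatim).

* §5 plumbing (`T2_concrete_eq`, `fix_of_matrix_fix`, `step2_factored`: §2's pair map with `T := mulVecLin (tOp …)`, `RG′D* := mulVecLin (R·G′·Dᵀ)`
  IS §1's; the resolvent form of (3.138) at MATRIX level gives the `Module.End` form) and §6 **`thm312_G1_rightEntry_concreteDelta2`** — THEOREM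
  3.12's RIGHT ENTRIES OF `G₁` ASSEMBLED: the `Δ⁽²⁾_π` step with the ACTUAL matrices `T = tOp`, `R·G′·Dᵀ`, `𝒢 = G₀ ⊕ G₀D` and `Δ⁽²⁾ = delta2
  (calC …)` CONCRETE, every other input a BOUND-letter (`T`, `RG′D*`: Theorem 3.1/(3.49); `G₀`, `G₀D`: Theorem 3.3; the `Δ′_π` step `G₀Δ′_π =
  𝒢∘𝒯₁` with `𝒯₁ ≦ c₁·Mα₀·e^{−δ_Td}`: (3.131); `G₀F`; a-priori `M₀`), the matrix resolvent form `G₁ = G₀ + G₀(Δ′_π + Δ⁽²⁾_π)G₁`, and the threshold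
  `Mα₀ ≦ (2D)⁻¹` with `D = κ_C·(max 1 κ_P·(B_G + B′_G)·(c₁ + c₂)·c)·c`, `c₂ = θ₀e^{δ_TR}C_Tc(1 + B₁c)`, `θ₀ = 2dC₃‖τ‖(Σ_i‖e_i‖)M_e c₀·#lv` EXPLICIT
  ⟹ `G₁F : b₀ → bC` has `2A·e^{−ρd}` (`ρ ≦ ρ_S`, `ρ + 3σ ≦ δ_T`, `ρ + 2σ ≦ δ_G`).

HONEST SCOPE / NOT CLAIMED.  (i) `T = 1 − DG′RD*` as an operator from the state norm to the sup norm (`hT`: print — `|DG′RD*f| ≦ (∇G′-letter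
(3.42)₂)·(R)·|D*f|`, the state norm controlling `D*f`), `RG′D*` (`hRG`: (3.43)/(3.42)₃ for `G′` after `R`), the two `G₀`-letters (`hG0`, `hG0D`:
Theorem 3.3) and, in §3, the `Δ′_π` factor `𝒯₁` with its identity and majorant (rows 3.120/3.130–3.131; `B9Ineq3131Letters` proves (3.131) at the
form level) are HYPOTHESES of the printed exponential shape between abstract block norms (scale weights inside the norms, `B9SectDSup` §1).  (ii)
Only the `Δ⁽²⁾` factor is discharged (§4); its `(L^{j′}η)^{−2}` is absorbed in FILE 74's flat units.  (iii) `Δ` symmetric (`hΔ`) is the input of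
`Tᵀ = 1 − DRG′D*` (print: `Δ = D*D`).  (iv) Rates/constants explicit, unoptimised; the a-priori bound `hap` and `q < 1` as in `B9SectDSup`.  (v)
This file is the printed route («derivatives … applied … to the operator … on the left») for the dressed summands of (3.135) inside (3.138);
FILE 76 `B9Delta2PiMajorant` §3–§4 remain kernel-true at the sup level with letters `hP`/`hPt` whose constants are not print's `O(1)` (located in
FILE 77 (v)).  Two-sided/Hölder/`L²` entries: `B9SectDSup.entry_majorant`, `B9SectDL2Decay` by reference.  NOT summit progress.

RELATED IN THE TREE, NOT DUPLICATED (searched 2026-08-24: stems `*3138*`, `*StepDelta*`, `*Delta2*`, `*piOp*`): p10 `B9Delta2Def134` (`delta2pi`,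
`tOp_transpose` — USED), `B9SectDFP` (`piOp`, `tOp` — USED), `B9SectDSup` (`prodNorm`, `hasMaj_prod`, `hasMaj_coprod_exp`, `rightEntry_of_factored`
— USED), r16 `B11SectG` (USED), FILE 74 (USED), FILE 76 (sup-level twin), FILE 77 `B9Eq3138FirstFactors` (the displayed first-factors estimate).
Unit `lit-balaban-r06`, HOME `run/shared/lean/pub/lit-balaban/`.
-/

noncomputable section

open scoped BigOperators Matrix

namespace Literature.MathematicalPhysics.QuantumFieldTheory.Balaban1983to89.B9Eq3138StepDelta2Pi

open Literature.MathematicalPhysics.QuantumFieldTheory.Balaban1983to89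
open B11SectG B6RandomWalk B9SectDSup

/-! ## §1 `G₀Δ⁽²⁾_π = G₀·Δ⁽²⁾T − (G₀D)·RG′D*Δ⁽²⁾T = 𝒢 ∘ 𝒯₂` -/

section Factorisation

variable {X n m : Type} [Fintype X] [Fintype n] [Fintype m] [DecidableEq X] [DecidableEq n] [DecidableEq m]

/-- **the outer derivative goes to the left**: for symmetric `Δ` (`Tᵀ = 1 − DRG′D*`, p10's `tOp_transpose`) and any `G₀`, `K`,
`G₀·(TᵀKT) = G₀·(KT) − (G₀D)·(RG′D*·K·T)`. [cite: Balaban1985BackgroundPropagators, (3.135) p.422, p.423 (after (3.138))] -/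
theorem mul_piOp_eq (G₀ K : Matrix X X ℝ) (Δ : Matrix n n ℝ) (Q : Matrix m n ℝ) (a : ℝ) (D : Matrix X n ℝ) (hΔ : Δ.IsSymm) :
    G₀ * B9SectDFP.piOp K Δ Q a D =
      G₀ * (K * B9SectDFP.tOp Δ Q a D) -
        G₀ * D * (B9H163.R Δ Q a * B9H163.G' Δ Q a * Dᵀ * K * B9SectDFP.tOp Δ Q a D) := by
  rw [B9SectDFP.piOp, B9Delta2Def134.tOp_transpose Δ Q a D hΔ]
  simp only [Matrix.sub_mul, Matrix.one_mul, Matrix.mul_sub, Matrix.mul_assoc]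

/-- **`G₀Δ⁽²⁾_π = 𝒢 ∘ 𝒯₂`** as linear maps: `𝒢(φ,ψ) = G₀φ + G₀Dψ` on pairs (bond configuration, site function) — `LinearMap.coprod` — and
`𝒯₂f = (Δ⁽²⁾Tf, −RG′D*Δ⁽²⁾Tf)` — `LinearMap.prod`; `Δ⁽²⁾_π = delta2pi 𝒞 Δ Q a D`, `Δ⁽²⁾ = delta2 𝒞`. The factored shape of
`B9SectDSup.factored_rightEntry_fix`. [cite: Balaban1985BackgroundPropagators, (3.135) p.422, (3.138) p.423] -/
theorem mulVecLin_mul_delta2pi (G₀ C : Matrix X X ℝ) (Δ : Matrix n n ℝ) (Q : Matrix m n ℝ) (a : ℝ) (D : Matrix X n ℝ)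
    (hΔ : Δ.IsSymm) :
    Matrix.mulVecLin (G₀ * B9Delta2Def134.delta2pi C Δ Q a D) =
      ((Matrix.mulVecLin G₀).coprod (Matrix.mulVecLin (G₀ * D))) ∘ₗ
        ((Matrix.mulVecLin (B9Delta2Def134.delta2 C * B9SectDFP.tOp Δ Q a D)).prod
          (Matrix.mulVecLin (-(B9H163.R Δ Q a * B9H163.G' Δ Q a * Dᵀ * B9Delta2Def134.delta2 C * B9SectDFP.tOp Δ Q a D)))) := by
  rw [LinearMap.coprod_comp_prod, B9Delta2Def134.delta2pi, mul_piOp_eq G₀ _ Δ Q a D hΔ]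
  refine LinearMap.ext fun μ => ?_
  simp only [LinearMap.add_apply, LinearMap.comp_apply, Matrix.mulVecLin_apply, Matrix.sub_mulVec, Matrix.neg_mulVec,
    Matrix.mulVec_neg, Matrix.mulVec_mulVec]
  abel

end Factorisation

/-! ## §2 The majorant of `𝒯₂ = (Δ⁽²⁾T, −RG′D*Δ⁽²⁾T)` from the letters, and of `𝒢 = G₀ ⊕ G₀D` -/

section Letters

variable {g : B6.Geometry} {FC FA P : Type} [AddCommGroup FC] [Module ℝ FC] [AddCommGroup FA] [Module ℝ FA]
  [AddCommGroup P] [Module ℝ P]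
variable {bC : BlockNorm g FC} {bA : BlockNorm g FA} {bP : BlockNorm g P}

/-- **the `𝒯₂`-majorant from the letters** ([4] (2.52)–(2.55) twice + «a summation preserves it also»): `T : bC → bA` with `C_Te^{−δ₁d}`,
`Δ⁽²⁾ : bA → bA` with `θe^{−δ₁d}`, `RG′D* : bA → bP` with `B₁e^{−δ₁d}` ⟹ the pair map `f ↦ (Δ⁽²⁾Tf, −RG′D*Δ⁽²⁾Tf)` into the product norm
`bA × bP` has the majorant `(κ_Aθ C_T c + κ_A B₁(κ_Aθ C_T c)c)·e^{−ρd}` for `ρ ≧ 0`, `σ ≧ 0`, `ρ + 2σ ≦ δ₁`.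
[cite: Balaban1985BackgroundPropagators, (3.135) p.422, (3.137)–(3.138) p.423] [cite: Balaban1984PropagatorsII, (2.52)–(2.55) p.232, (2.61) p.234] -/
theorem hasMaj_T2 {Top : FC →ₗ[ℝ] FA} {Δ2 : FA →ₗ[ℝ] FA} {RGDs : FA →ₗ[ℝ] P} {CT θ B₁ δ₁ ρ σ c : ℝ}
    (htri : Triangle254 g) (hd : ∀ a b : g.Site, 0 ≤ g.dist a b) (hrow : RowSum g σ c)
    (hCT : 0 ≤ CT) (hθ : 0 ≤ θ) (hB₁ : 0 ≤ B₁) (hρ : 0 ≤ ρ) (hσ : 0 ≤ σ) (hρδ : ρ + 2 * σ ≤ δ₁)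
    (hT : HasMaj bC bA Top (fun a b => CT * Real.exp (-(δ₁ * g.dist a b))))
    (hΔ : HasMaj bA bA Δ2 (fun a b => θ * Real.exp (-(δ₁ * g.dist a b))))
    (hRG : HasMaj bA bP RGDs (fun a b => B₁ * Real.exp (-(δ₁ * g.dist a b)))) :
    HasMaj bC (prodNorm bA bP) ((Δ2 ∘ₗ Top).prod (-(RGDs ∘ₗ (Δ2 ∘ₗ Top))))
      (fun a b => (bA.κ * θ * CT * c + bA.κ * B₁ * (bA.κ * θ * CT * c) * c) * Real.exp (-(ρ * g.dist a b))) := by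
  have hc : 0 ≤ c ∨ IsEmpty g.Site := by
    by_cases hne : Nonempty g.Site
    · exact Or.inl (hrow.nonneg (Classical.arbitrary _))
    · exact Or.inr (not_nonempty_iff.mp hne)
  rcases hc with hc | hemp
  swap
  · intro y' μ hμ y
    exact (IsEmpty.false y).elim
  -- first component at the rate `ρ`, and once more at the rate `ρ + σ` as the input of the second component
  have h1 : HasMaj bC bA (Δ2 ∘ₗ Top) (fun a b => bA.κ * θ * CT * c * Real.exp (-(ρ * g.dist a b))) :=
    hasMaj_comp_exp htri hd hrow hθ hCT hρ (by linarith) (by linarith) hΔ hT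
  have h1' : HasMaj bC bA (Δ2 ∘ₗ Top) (fun a b => bA.κ * θ * CT * c * Real.exp (-((ρ + σ) * g.dist a b))) :=
    hasMaj_comp_exp htri hd hrow hθ hCT (by linarith) (by linarith) (by linarith) hΔ hT
  have h2 : HasMaj bC bP (RGDs ∘ₗ (Δ2 ∘ₗ Top))
      (fun a b => bA.κ * B₁ * (bA.κ * θ * CT * c) * c * Real.exp (-(ρ * g.dist a b))) :=
    hasMaj_comp_exp htri hd hrow hB₁ (mul_nonneg (mul_nonneg (mul_nonneg bA.κ_nonneg hθ) hCT) hc) hρ (by linarith) (by linarith) hRG h1'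
  exact (hasMaj_prod h1 h2.neg).mono fun a b => le_of_eq (by ring)

/-- **the `𝒢`-majorant** (`𝒢(φ,ψ) = G₀φ + G₀Dψ` out of the product norm): `G₀ : bA → bC` with `B_Ge^{−δ_Gd}` (Theorem 3.3 (3.42)₁/(3.43)₁ for
`G₀`) and `G₀D : bP → bC` with `B′_Ge^{−δ_Gd}` ((3.42)₃/(3.43)₂/(3.45) for `G₀`, «the choice of derivatives ∇_U, ∇\*_U is conventional») ⟹ `𝒢`
has `(B_G + B′_G)e^{−δ_Gd}` (`B9SectDSup.hasMaj_coprod_exp`). [cite: Balaban1985BackgroundPropagators, (3.42)–(3.45) pp.397–398, (3.138) p.423] -/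
theorem hasMaj_G {G0 : FA →ₗ[ℝ] FC} {G0D : P →ₗ[ℝ] FC} {BG BG' δG : ℝ} (hd : ∀ a b : g.Site, 0 ≤ g.dist a b)
    (hBG : 0 ≤ BG) (hBG' : 0 ≤ BG')
    (hG0 : HasMaj bA bC G0 (fun a b => BG * Real.exp (-(δG * g.dist a b))))
    (hG0D : HasMaj bP bC G0D (fun a b => BG' * Real.exp (-(δG * g.dist a b)))) :
    HasMaj (prodNorm bA bP) bC (G0.coprod G0D) (fun a b => (BG + BG') * Real.exp (-(δG * g.dist a b))) :=
  hasMaj_coprod_exp hd hBG hBG' le_rfl le_rfl hG0 hG0D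

end Letters

/-! ## §3 (3.138) for the right entries `G₁F` in the factored form -/

section RightEntries

variable {g : B6.Geometry} {F₀ FC FA P : Type} [AddCommGroup F₀] [Module ℝ F₀] [AddCommGroup FC] [Module ℝ FC]
  [AddCommGroup FA] [Module ℝ FA] [AddCommGroup P] [Module ℝ P]

/-- the resolvent form of (3.138) in the factored shape: `G₁ = G₀ + G₀(Δ′_π + Δ⁽²⁾_π)G₁` with `G₀Δ′_π = 𝒢∘𝒯₁` and `G₀Δ⁽²⁾_π = 𝒢∘𝒯₂` gives
`G₁ = G₀ + 𝒢∘(𝒯₁ + 𝒯₂)∘G₁`. [cite: Balaban1985BackgroundPropagators, (3.138) p.423] -/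
theorem fix_factored {G1 G0 S1 S2 : Module.End ℝ FC} {𝒢 : FA →ₗ[ℝ] FC} {𝒯₁ 𝒯₂ : FC →ₗ[ℝ] FA}
    (hfix : G1 = G0 + G0 * (S1 + S2) * G1) (h1 : G0 * S1 = 𝒢 ∘ₗ 𝒯₁) (h2 : G0 * S2 = 𝒢 ∘ₗ 𝒯₂) :
    G1 = G0 + 𝒢 ∘ₗ (𝒯₁ + 𝒯₂) ∘ₗ G1 := by
  have h : G0 * (S1 + S2) = 𝒢 ∘ₗ (𝒯₁ + 𝒯₂) := by
    rw [mul_add, h1, h2, ← LinearMap.comp_add]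
  conv_lhs => rw [hfix, h]
  rfl

/-- **(3.138) FOR THE RIGHT ENTRIES `G₁F`, FACTORED** — «the series (3.138) is convergent for α₀ restricted by a small, absolute constant …
This implies that the theorem is valid for G₁» for the entries reachable from the state norm `bC`: the `Δ′_π` step as a letter
(`G₀Δ′_π = 𝒢∘𝒯₁`, `𝒯₁ : bC → bA × bP` with `C₁e^{−δ_Td}` — rows 3.120/3.131), the `Δ⁽²⁾_π` step from §1–§2 (`G₀Δ⁽²⁾_π = 𝒢∘𝒯₂`, `𝒯₂` with
`C₂e^{−δ_Td}`), `𝒢 = G₀ ⊕ G₀D : bA × bP → bC` with `B_𝒢e^{−δ_Gd}`, the source entry `G₀F` with `Ae^{−ρ_Sd}`, the resolvent form of (3.138), an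
a-priori bound `M₀` and `q = κ_C(κ_{A×P}B_𝒢(C₁ + C₂)c)c < 1` ⟹ `G₁F : b₀ → bC` has `A(1 − q)⁻¹e^{−ρd}`, `ρ ≦ ρ_S`, `ρ + σ ≦ δ_T`, `ρ + 2σ ≦ δ_G`
(`B9SectDSup.rightEntry_of_factored`). [cite: Balaban1985BackgroundPropagators, (3.138) p.423, Thm 3.12 p.423]
[cite: Balaban1984PropagatorsII, (2.52)–(2.55) p.232, Lemma 2.1 (2.61) p.234] -/
theorem rightEntry_G1_factored {b₀ : BlockNorm g F₀} {bC : BlockNorm g FC} {bAP : BlockNorm g FA}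
    {G1 G0 S1 S2 : Module.End ℝ FC} {𝒢 : FA →ₗ[ℝ] FC} {𝒯₁ 𝒯₂ : FC →ₗ[ℝ] FA} {Fop : F₀ →ₗ[ℝ] FC}
    {C₁ C₂ BG A M₀ δT δG ρS ρ σ c : ℝ}
    (htri : Triangle254 g) (hd : ∀ a b : g.Site, 0 ≤ g.dist a b) (hrow : RowSum g σ c)
    (hC₁ : 0 ≤ C₁) (hC₂ : 0 ≤ C₂) (hBG : 0 ≤ BG) (hA : 0 ≤ A) (hM₀ : 0 ≤ M₀) (hρ : 0 ≤ ρ) (hσ : 0 ≤ σ) (hρS : ρ ≤ ρS)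
    (hρT : ρ + σ ≤ δT) (hρG : ρ + 2 * σ ≤ δG)
    (hfix : G1 = G0 + G0 * (S1 + S2) * G1) (h1 : G0 * S1 = 𝒢 ∘ₗ 𝒯₁) (h2 : G0 * S2 = 𝒢 ∘ₗ 𝒯₂)
    (hT1 : HasMaj bC bAP 𝒯₁ (fun a b => C₁ * Real.exp (-(δT * g.dist a b))))
    (hT2 : HasMaj bC bAP 𝒯₂ (fun a b => C₂ * Real.exp (-(δT * g.dist a b))))
    (hG : HasMaj bAP bC 𝒢 (fun a b => BG * Real.exp (-(δG * g.dist a b))))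
    (hS : HasMaj b₀ bC (G0 ∘ₗ Fop) (fun a b => A * Real.exp (-(ρS * g.dist a b))))
    (hap : HasMaj b₀ bC (G1 ∘ₗ Fop) (fun _ _ => M₀))
    (hq : bC.κ * (bAP.κ * BG * (C₁ + C₂) * c) * c < 1) :
    HasMaj b₀ bC (G1 ∘ₗ Fop)
      (fun a b => A * (1 - bC.κ * (bAP.κ * BG * (C₁ + C₂) * c) * c)⁻¹ * Real.exp (-(ρ * g.dist a b))) :=
  rightEntry_of_factored htri hd hrow (add_nonneg hC₁ hC₂) hBG hA hM₀ hρ hσ hρS hρT hρG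
    ((hT1.add hT2).mono fun a b => le_of_eq (by ring)) hG hS (fix_factored hfix h1 h2) hap hq

/-- **(3.138) FOR THE TWO-SIDED ENTRIES `EG₁F`, FACTORED** («The convergence is in all norms appearing in the formulation of Theorem 3.3»,
the entries where an output map `E` — print: `∇_U`, `ζ∇_U·` — meets `G₁`): with the same factorisation `G₁ = G₀ + 𝒢(𝒯₁ + 𝒯₂)G₁`, the output
letter `E𝒢 : bA × bP → b₃` (`B_Ee^{−ρ_Ed}`: the (3.42)₂/(3.43)₁/(3.44)/(3.45) entries of `G₀` — the ONLY place a mixed kernel is evaluated), the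
`E`-entry of `G₀F` (`A_{EF}e^{−ρ₁d}`, Theorem 3.3) and the right entry `G₁F` (`A′e^{−ρd}`, `rightEntry_G1_factored`): `EG₁F` has
`(A_{EF} + κ_{A×P}B_E(κ_C(C₁ + C₂)A′c)c)·e^{−ρd}` (`B9SectDSup.entry_majorant`). [cite: Balaban1985BackgroundPropagators, (3.138) p.423,
Thm 3.12 p.423] [cite: Balaban1984PropagatorsII, (2.52)–(2.55) p.232, Lemma 2.1 (2.61) p.234] -/
theorem entry_G1_factored {F₃ : Type} [AddCommGroup F₃] [Module ℝ F₃]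
    {b₀ : BlockNorm g F₀} {bC : BlockNorm g FC} {bAP : BlockNorm g FA} {b₃ : BlockNorm g F₃}
    {G1 G0 S1 S2 : Module.End ℝ FC} {𝒢 : FA →ₗ[ℝ] FC} {𝒯₁ 𝒯₂ : FC →ₗ[ℝ] FA} {Eop : FC →ₗ[ℝ] F₃} {Fop : F₀ →ₗ[ℝ] FC}
    {BE C₁ C₂ AEF A' ρE δT ρ₁ ρ σ c : ℝ}
    (htri : Triangle254 g) (hd : ∀ a b : g.Site, 0 ≤ g.dist a b) (hrow : RowSum g σ c)
    (hBE : 0 ≤ BE) (hC₁ : 0 ≤ C₁) (hC₂ : 0 ≤ C₂) (hAEF : 0 ≤ AEF) (hA' : 0 ≤ A') (hρ : 0 ≤ ρ)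
    (hρT : ρ + σ ≤ δT) (hρE : ρ + σ ≤ ρE) (hρ₁ : ρ ≤ ρ₁)
    (hfix : G1 = G0 + G0 * (S1 + S2) * G1) (h1 : G0 * S1 = 𝒢 ∘ₗ 𝒯₁) (h2 : G0 * S2 = 𝒢 ∘ₗ 𝒯₂)
    (hE : HasMaj bAP b₃ (Eop ∘ₗ 𝒢) (fun a b => BE * Real.exp (-(ρE * g.dist a b))))
    (hT1 : HasMaj bC bAP 𝒯₁ (fun a b => C₁ * Real.exp (-(δT * g.dist a b))))
    (hT2 : HasMaj bC bAP 𝒯₂ (fun a b => C₂ * Real.exp (-(δT * g.dist a b))))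
    (hEF : HasMaj b₀ b₃ (Eop ∘ₗ G0 ∘ₗ Fop) (fun a b => AEF * Real.exp (-(ρ₁ * g.dist a b))))
    (hGF : HasMaj b₀ bC (G1 ∘ₗ Fop) (fun a b => A' * Real.exp (-(ρ * g.dist a b)))) :
    HasMaj b₀ b₃ (Eop ∘ₗ G1 ∘ₗ Fop)
      (fun a b => (AEF + bAP.κ * BE * (bC.κ * (C₁ + C₂) * A' * c) * c) * Real.exp (-(ρ * g.dist a b))) :=
  entry_majorant htri hd hrow hBE (add_nonneg hC₁ hC₂) hAEF hA' hρ hρT hρE hρ₁ hE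
    ((hT1.add hT2).mono fun a b => le_of_eq (by ring)) hEF hGF (fix_factored hfix h1 h2)

/-- **«the series (3.138) is convergent for α₀ restricted by a small, absolute constant»** — THE SMALLNESS LOCATED (as in
`B9SectDSup.thm312_rightEntry_shape`): when the two step constants are LINEAR in `m := Mα₀` — `C₁ = c₁·m` (the (3.131) letter for `Δ′_π`,
«O(1)Mα₀») and `C₂ = c₂·m` (§2/§4: `θ = O(1)Mα₀`) — and `m ≦ (2D)⁻¹` with `D := κ_C(κ_{A×P}B_𝒢(c₁ + c₂)c)c` (whenever `D > 0`), then
`q = D·m ≦ ½` and the right entries `G₁F` have the majorant `2A·e^{−ρd}` — Theorem 3.3's right entries for `G₁` with the constant doubled.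
[cite: Balaban1985BackgroundPropagators, (3.138) p.423, Thm 3.12 p.423] [cite: Balaban1984PropagatorsII, Lemma 2.1 (2.61) p.234] -/
theorem rightEntry_G1_small {b₀ : BlockNorm g F₀} {bC : BlockNorm g FC} {bAP : BlockNorm g FA}
    {G1 G0 S1 S2 : Module.End ℝ FC} {𝒢 : FA →ₗ[ℝ] FC} {𝒯₁ 𝒯₂ : FC →ₗ[ℝ] FA} {Fop : F₀ →ₗ[ℝ] FC}
    {c₁ c₂ m BG A M₀ δT δG ρS ρ σ c : ℝ}
    (htri : Triangle254 g) (hd : ∀ a b : g.Site, 0 ≤ g.dist a b) (hrow : RowSum g σ c) (hc : 0 ≤ c)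
    (hc₁ : 0 ≤ c₁) (hc₂ : 0 ≤ c₂) (hm : 0 ≤ m) (hBG : 0 ≤ BG) (hA : 0 ≤ A) (hM₀ : 0 ≤ M₀) (hρ : 0 ≤ ρ) (hσ : 0 ≤ σ)
    (hρS : ρ ≤ ρS) (hρT : ρ + σ ≤ δT) (hρG : ρ + 2 * σ ≤ δG)
    (hfix : G1 = G0 + G0 * (S1 + S2) * G1) (h1 : G0 * S1 = 𝒢 ∘ₗ 𝒯₁) (h2 : G0 * S2 = 𝒢 ∘ₗ 𝒯₂)
    (hT1 : HasMaj bC bAP 𝒯₁ (fun a b => c₁ * m * Real.exp (-(δT * g.dist a b))))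
    (hT2 : HasMaj bC bAP 𝒯₂ (fun a b => c₂ * m * Real.exp (-(δT * g.dist a b))))
    (hG : HasMaj bAP bC 𝒢 (fun a b => BG * Real.exp (-(δG * g.dist a b))))
    (hS : HasMaj b₀ bC (G0 ∘ₗ Fop) (fun a b => A * Real.exp (-(ρS * g.dist a b))))
    (hap : HasMaj b₀ bC (G1 ∘ₗ Fop) (fun _ _ => M₀))
    (hsmall : 0 < bC.κ * (bAP.κ * BG * (c₁ + c₂) * c) * c → m ≤ (2 * (bC.κ * (bAP.κ * BG * (c₁ + c₂) * c) * c))⁻¹) :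
    HasMaj b₀ bC (G1 ∘ₗ Fop) (fun a b => 2 * A * Real.exp (-(ρ * g.dist a b))) := by
  have hD : 0 ≤ bC.κ * (bAP.κ * BG * (c₁ + c₂) * c) * c :=
    mul_nonneg (mul_nonneg bC.κ_nonneg (mul_nonneg (mul_nonneg (mul_nonneg bAP.κ_nonneg hBG) (add_nonneg hc₁ hc₂)) hc)) hc
  have hq' : bC.κ * (bAP.κ * BG * (c₁ + c₂) * c) * c * m ≤ 1 / 2 := mul_le_half_of_le_inv hD hsmall
  have hq : bC.κ * (bAP.κ * BG * (c₁ * m + c₂ * m) * c) * c ≤ 1 / 2 := by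
    rw [show bC.κ * (bAP.κ * BG * (c₁ * m + c₂ * m) * c) * c = bC.κ * (bAP.κ * BG * (c₁ + c₂) * c) * c * m by ring]
    exact hq'
  have h := rightEntry_G1_factored htri hd hrow (mul_nonneg hc₁ hm) (mul_nonneg hc₂ hm) hBG hA hM₀ hρ hσ hρS hρT hρG hfix h1 h2
    hT1 hT2 hG hS hap (lt_one_of_le_half hq)
  exact h.mono fun a b => mul_le_mul_of_nonneg_right (const_le_two_mul hA hq) (Real.exp_nonneg _)

end RightEntries

/-! ## §4 `𝒯₂` with the `Δ⁽²⁾` factor CONCRETE (`Δ⁽²⁾ = delta2 calC`, FILE 74) -/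

section Concrete

open NormedSpace Finset Metric Filter
open B7Prop1Explicit B7Prop1Local B7Prop2Explicit B7Prop3Flat B7Prop4Flat B7Eq92Concrete B7Prop3GeneralLinear
  B7Prop4GeneralLevels B7Prop5GeneralOperators B7Prop5GeneralInduction B7Prop5GeneralLevels B7Ineq149Pairing B7Eq136SecondOrder
  B9Ineq3137From149 B9Eq3134MatrixConcrete

variable {d : ℕ}
variable {𝔸 : Type*} [NormedRing 𝔸] [NormedAlgebra ℂ 𝔸] [CompleteSpace 𝔸] [NormOneClass 𝔸]

variable (L : ℕ) (hL : 2 ≤ L) {G : Subgroup 𝔸ˣ} (hG : AvgClosed d L G) (k : ℕ)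
  (U₀ : B7Prop1Explicit.Site d → Fin d → 𝔸ˣ) (hU₀ : ∀ x κ, U₀ x κ ∈ G) {α₀ : ℝ} (hα : 0 < α₀)
  (hα3 : C0 d * α₀ ≤ 1 / 3) (hα4 : 4 * α₀ ≤ c2' d L) (h52 : pdev U₀ < α₀ * (((L : ℝ) ^ k)⁻¹) ^ 2)
  {b : ℝ} (hb : 0 < b)
  (hsmall : Real.exp (4 * (800 * ((d : ℝ) + 1) ^ 2 * ((d : ℝ) + 4)) * α₀)
    * (1 + 8 * (131072 * ((d : ℝ) + 1) ^ 2) * ((L : ℝ) ^ k * b)) ≤ 2)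
  (hc₃ : 4 * ((L : ℝ) ^ k * b) < c3 d L)
  (h145 : 8 * d * thetaGen d L α₀ * (L : ℝ)⁻¹ ^ 4 ≤ 1)
  (h155 : (2 * (L : ℝ) - 1) * (L : ℝ)⁻¹ ^ 2 + 2 * d * thetaGen d L α₀ * (L : ℝ)⁻¹ ^ 3
    + 1 / 8 * (1 + 2 * d * thetaGen d L α₀ * (L : ℝ)⁻¹ ^ 2 + 2 * d * C3Gen d L * ((L : ℝ) ^ k * b)) * (L : ℝ)⁻¹ ^ 2 ≤ 1)
  (S : Finset (B7Prop1Explicit.Site d × Fin d))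
  (lv : Finset ℕ) (T : ℕ → Finset (B7Prop1Explicit.Site d × Fin d)) (w : ℕ → B7Prop1Explicit.Site d × Fin d → ℝ)
  (K : ℕ → B7Prop1Explicit.Site d × Fin d → 𝔸)

variable {ι : Type} [Fintype ι] (e : ι → 𝔸) (τ : 𝔸 →L[ℝ] ℝ)
variable {g : B6.Geometry} (blk : S × ι → g.Site)
variable {FC P : Type} [AddCommGroup FC] [Module ℝ FC] [AddCommGroup P] [Module ℝ P]

include hL hG hU₀ hα hα3 hα4 h52 hb hsmall hc₃ h145 h155 in
/-- **`𝒯₂` WITH `Δ⁽²⁾` CONCRETE**: for the realised `Δ⁽²⁾ = delta2 calC` of FILE 74 (its `(H*J)`-budget `w_j(c)‖K_j(c)‖ ≦ c₀Mα₀(Lʲ)^{d−2}`,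
`2 ≦ d`, `‖e_i‖ ≦ M_e`, box range `R` on `blk`, row sum (2.61) at `σ` with constant `cr`, triangle inequality (2.54)) on the sharp-block sup
sizes of the real coordinates, and the letters `T = tOp Δ Q a D : bC → sup` (`C_Te^{−δ₁d}`), `RG′D* : sup → bP` (`B₁e^{−δ₁d}`) — ANY linear maps
with these majorants — the pair map `f ↦ (Δ⁽²⁾Tf, −RG′D*Δ⁽²⁾Tf)` into `sup × bP` has the majorant `[θ C_T cr(1 + B₁cr)]·e^{−ρd}`, `θ =
θ_Δe^{δ₁R}`, `θ_Δ = [2dC₃‖τ‖(Σ_i‖e_i‖)M_e c₀·#lv]·(Mα₀)` — «small in a proper sense», `O(1)·Mα₀` — for `ρ ≧ 0`, `σ ≧ 0`, `ρ + 2σ ≦ δ₁`.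
[cite: Balaban1985BackgroundPropagators, (3.135) p.422, (3.137)–(3.138) p.423] [cite: Balaban1984PropagatorsII, (2.51)–(2.55) p.232, (2.61) p.234]
[cite: Balaban1985Averaging, (149) p.40] -/
theorem hasMaj_T2_concrete (hd : 2 ≤ d) (hJ : ∀ j ∈ lv, j ≤ k) (hw : ∀ j ∈ lv, ∀ c ∈ T j, 0 ≤ w j c)
    {c₀ M Me : ℝ} (hc₀ : 0 ≤ c₀ * M) (hMe : 0 ≤ Me) (he : ∀ i, ‖e i‖ ≤ Me)
    (hK : ∀ j ∈ lv, ∀ c ∈ T j, w j c * ‖K j c‖ ≤ c₀ * M * α₀ * ((L : ℝ) ^ j) ^ (d - 2))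
    {R : ℝ} {δ₁ ρ σ cr CT B₁ : ℝ}
    (hR : ∀ j ∈ lv, ∀ c ∈ T j, ∀ y y' : g.Site, BoxMeets L S blk j c y → BoxMeets L S blk j c y' → g.dist y y' ≤ R)
    (htri : B6RandomWalk.Triangle254 g) (hdist : ∀ y y' : g.Site, 0 ≤ g.dist y y') (hrow : RowSum g σ cr)
    (hCT : 0 ≤ CT) (hB₁ : 0 ≤ B₁) (hρ : 0 ≤ ρ) (hσ : 0 ≤ σ) (hρδ : ρ + 2 * σ ≤ δ₁)
    {bC : BlockNorm g FC} {bP : BlockNorm g P} {Top : FC →ₗ[ℝ] (S × ι → ℝ)} {RGDs : (S × ι → ℝ) →ₗ[ℝ] P}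
    (hT : HasMaj bC (BlockNorm.ofBlocks g blk) Top (fun a b => CT * Real.exp (-(δ₁ * g.dist a b))))
    (hRG : HasMaj (BlockNorm.ofBlocks g blk) bP RGDs (fun a b => B₁ * Real.exp (-(δ₁ * g.dist a b)))) :
    HasMaj bC (prodNorm (BlockNorm.ofBlocks g blk) bP)
      ((Matrix.mulVecLin (B9Delta2Def134.delta2 (calC L U₀ S lv T w K e τ)) ∘ₗ Top).prod
        (-(RGDs ∘ₗ (Matrix.mulVecLin (B9Delta2Def134.delta2 (calC L U₀ S lv T w K e τ)) ∘ₗ Top))))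
      (fun a b => (((2 * d * C3Gen d L * ‖τ‖ * (∑ i, ‖e i‖) * Me * c₀ * lv.card) * (M * α₀) * Real.exp (δ₁ * R)) * CT * cr *
        (1 + B₁ * cr)) * Real.exp (-(ρ * g.dist a b))) := by
  have hδ₁ : 0 ≤ δ₁ := by linarith
  have hΔ2 := hasMaj_delta2_calC_exp L hL hG k U₀ hU₀ hα hα3 hα4 h52 hb hsmall hc₃ h145 h155 S lv T w K e τ blk hd hJ hw hc₀
    hMe he hK hδ₁ hR
  have hE : 0 ≤ ∑ i, ‖e i‖ := Finset.sum_nonneg fun i _ => norm_nonneg _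
  have hC := C3Gen_nonneg d L
  have hθ : 0 ≤ (2 * d * C3Gen d L * ‖τ‖ * (∑ i, ‖e i‖) * Me * c₀ * lv.card) * (M * α₀) * Real.exp (δ₁ * R) := by
    rw [show (2 * d * C3Gen d L * ‖τ‖ * (∑ i, ‖e i‖) * Me * c₀ * lv.card) * (M * α₀) * Real.exp (δ₁ * R) =
        2 * d * C3Gen d L * ‖τ‖ * (∑ i, ‖e i‖) * Me * lv.card * (c₀ * M * α₀) * Real.exp (δ₁ * R) by ring]
    have : 0 ≤ c₀ * M * α₀ := mul_nonneg hc₀ hα.le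
    positivity
  have h := hasMaj_T2 (bA := BlockNorm.ofBlocks g blk) htri hdist hrow hCT hθ hB₁ hρ hσ hρδ hT hΔ2 hRG
  refine h.mono fun a b => le_of_eq ?_
  rw [show (BlockNorm.ofBlocks g blk).κ = (1 : ℝ) from rfl]
  ring

end Concrete

/-! ## §5 Plumbing: the matrix factorisation of §1 in the shape §2–§3 consume -/

section Plumbing

variable {X n m : Type} [Fintype X] [Fintype n] [Fintype m] [DecidableEq X] [DecidableEq n] [DecidableEq m]

/-- the abstract pair map of §2 with `T := mulVecLin (tOp Δ Q a D)`, `RG′D* := mulVecLin (R·G′·Dᵀ)` IS the pair map of `mulVecLin_mul_delta2pi`.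
[cite: Balaban1985BackgroundPropagators, (3.135) p.422, (3.138) p.423] -/
theorem T2_concrete_eq (C : Matrix X X ℝ) (Δ : Matrix n n ℝ) (Q : Matrix m n ℝ) (a : ℝ) (D : Matrix X n ℝ) :
    (Matrix.mulVecLin (B9Delta2Def134.delta2 C) ∘ₗ Matrix.mulVecLin (B9SectDFP.tOp Δ Q a D)).prod
        (-(Matrix.mulVecLin (B9H163.R Δ Q a * B9H163.G' Δ Q a * Dᵀ) ∘ₗ
          (Matrix.mulVecLin (B9Delta2Def134.delta2 C) ∘ₗ Matrix.mulVecLin (B9SectDFP.tOp Δ Q a D)))) =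
      (Matrix.mulVecLin (B9Delta2Def134.delta2 C * B9SectDFP.tOp Δ Q a D)).prod
        (Matrix.mulVecLin (-(B9H163.R Δ Q a * B9H163.G' Δ Q a * Dᵀ * B9Delta2Def134.delta2 C * B9SectDFP.tOp Δ Q a D))) := by
  have h1 : Matrix.mulVecLin (B9Delta2Def134.delta2 C) ∘ₗ Matrix.mulVecLin (B9SectDFP.tOp Δ Q a D) =
      Matrix.mulVecLin (B9Delta2Def134.delta2 C * B9SectDFP.tOp Δ Q a D) := (Matrix.mulVecLin_mul _ _).symm
  have h2 : -(Matrix.mulVecLin (B9H163.R Δ Q a * B9H163.G' Δ Q a * Dᵀ) ∘ₗ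
        (Matrix.mulVecLin (B9Delta2Def134.delta2 C) ∘ₗ Matrix.mulVecLin (B9SectDFP.tOp Δ Q a D))) =
      Matrix.mulVecLin (-(B9H163.R Δ Q a * B9H163.G' Δ Q a * Dᵀ * B9Delta2Def134.delta2 C * B9SectDFP.tOp Δ Q a D)) := by
    refine LinearMap.ext fun μ => ?_
    simp only [LinearMap.neg_apply, LinearMap.comp_apply, Matrix.mulVecLin_apply, Matrix.mulVec_mulVec, Matrix.neg_mulVec,
      Matrix.mul_assoc]
  rw [h2, h1]

omit [Fintype n] [Fintype m] [DecidableEq X] [DecidableEq n] [DecidableEq m] in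
/-- the resolvent form of (3.138) at MATRIX level, `G₁ = G₀ + G₀(Δ′_π + Δ⁽²⁾_π)G₁`, gives the `Module.End` form (`mulVecLin` is a ring map).
[cite: Balaban1985BackgroundPropagators, (3.138) p.423] -/
theorem fix_of_matrix_fix (G1m G0m S1m S2m : Matrix X X ℝ) (hfixm : G1m = G0m + G0m * (S1m + S2m) * G1m) :
    Matrix.mulVecLin G1m =
      Matrix.mulVecLin G0m + Matrix.mulVecLin G0m * (Matrix.mulVecLin S1m + Matrix.mulVecLin S2m) * Matrix.mulVecLin G1m := by
  conv_lhs => rw [hfixm]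
  rw [Matrix.mulVecLin_add, Matrix.mulVecLin_mul, Matrix.mulVecLin_mul, Matrix.mulVecLin_add]
  rfl

/-- §1's `G₀Δ⁽²⁾_π = 𝒢∘𝒯₂` in the `Module.End` product form with the concrete `T`, `RG′D*`.
[cite: Balaban1985BackgroundPropagators, (3.135) p.422, (3.138) p.423] -/
theorem step2_factored (G0m C : Matrix X X ℝ) (Δ : Matrix n n ℝ) (Q : Matrix m n ℝ) (a : ℝ) (D : Matrix X n ℝ) (hΔ : Δ.IsSymm) :
    Matrix.mulVecLin G0m * Matrix.mulVecLin (B9Delta2Def134.delta2pi C Δ Q a D) =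
      ((Matrix.mulVecLin G0m).coprod (Matrix.mulVecLin (G0m * D))) ∘ₗ
        ((Matrix.mulVecLin (B9Delta2Def134.delta2 C) ∘ₗ Matrix.mulVecLin (B9SectDFP.tOp Δ Q a D)).prod
          (-(Matrix.mulVecLin (B9H163.R Δ Q a * B9H163.G' Δ Q a * Dᵀ) ∘ₗ
            (Matrix.mulVecLin (B9Delta2Def134.delta2 C) ∘ₗ Matrix.mulVecLin (B9SectDFP.tOp Δ Q a D))))) := by
  rw [T2_concrete_eq, ← mulVecLin_mul_delta2pi G0m C Δ Q a D hΔ, Matrix.mulVecLin_mul]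
  rfl

end Plumbing

/-! ## §6 Theorem 3.12's right entries for `G₁` ASSEMBLED: the `Δ⁽²⁾_π` step explicit, `Δ⁽²⁾` concrete -/

section Assembled

open NormedSpace Finset Metric Filter
open B7Prop1Explicit B7Prop1Local B7Prop2Explicit B7Prop3Flat B7Prop4Flat B7Eq92Concrete B7Prop3GeneralLinear
  B7Prop4GeneralLevels B7Prop5GeneralOperators B7Prop5GeneralInduction B7Prop5GeneralLevels B7Ineq149Pairing B7Eq136SecondOrder
  B9Ineq3137From149 B9Eq3134MatrixConcrete

variable {d : ℕ}
variable {𝔸 : Type*} [NormedRing 𝔸] [NormedAlgebra ℂ 𝔸] [CompleteSpace 𝔸] [NormOneClass 𝔸]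

variable (L : ℕ) (hL : 2 ≤ L) {G : Subgroup 𝔸ˣ} (hG : AvgClosed d L G) (k : ℕ)
  (U₀ : B7Prop1Explicit.Site d → Fin d → 𝔸ˣ) (hU₀ : ∀ x κ, U₀ x κ ∈ G) {α₀ : ℝ} (hα : 0 < α₀)
  (hα3 : C0 d * α₀ ≤ 1 / 3) (hα4 : 4 * α₀ ≤ c2' d L) (h52 : pdev U₀ < α₀ * (((L : ℝ) ^ k)⁻¹) ^ 2)
  {b : ℝ} (hb : 0 < b)
  (hsmall : Real.exp (4 * (800 * ((d : ℝ) + 1) ^ 2 * ((d : ℝ) + 4)) * α₀)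
    * (1 + 8 * (131072 * ((d : ℝ) + 1) ^ 2) * ((L : ℝ) ^ k * b)) ≤ 2)
  (hc₃ : 4 * ((L : ℝ) ^ k * b) < c3 d L)
  (h145 : 8 * d * thetaGen d L α₀ * (L : ℝ)⁻¹ ^ 4 ≤ 1)
  (h155 : (2 * (L : ℝ) - 1) * (L : ℝ)⁻¹ ^ 2 + 2 * d * thetaGen d L α₀ * (L : ℝ)⁻¹ ^ 3
    + 1 / 8 * (1 + 2 * d * thetaGen d L α₀ * (L : ℝ)⁻¹ ^ 2 + 2 * d * C3Gen d L * ((L : ℝ) ^ k * b)) * (L : ℝ)⁻¹ ^ 2 ≤ 1)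
  (S : Finset (B7Prop1Explicit.Site d × Fin d))
  (lv : Finset ℕ) (T : ℕ → Finset (B7Prop1Explicit.Site d × Fin d)) (w : ℕ → B7Prop1Explicit.Site d × Fin d → ℝ)
  (K : ℕ → B7Prop1Explicit.Site d × Fin d → 𝔸)

variable {ι : Type} [Fintype ι] [DecidableEq ι] (e : ι → 𝔸) (τ : 𝔸 →L[ℝ] ℝ)
variable {g : B6.Geometry} (blk : S × ι → g.Site)
variable {n m : Type} [Fintype n] [Fintype m] [DecidableEq n] [DecidableEq m]
variable {F₀ P : Type} [AddCommGroup F₀] [Module ℝ F₀] [AddCommGroup P] [Module ℝ P]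

include hL hG hU₀ hα hα3 hα4 h52 hb hsmall hc₃ h145 h155 in
/-- **THEOREM 3.12, RIGHT ENTRIES OF `G₁` — THE `Δ⁽²⁾_π` STEP EXPLICIT, `Δ⁽²⁾` CONCRETE.**  Matrices `G1m`, `G0m` (`G₁`, `G₀`), `S1m` (`Δ′_π`),
`Δ` symmetric, `Q`, `a`, `D` over the bond index type `S × ι` and the site index type `n`; the resolvent form of (3.138)
`G₁ = G₀ + G₀(Δ′_π + Δ⁽²⁾_π)G₁` with `Δ⁽²⁾_π = delta2pi (calC …) Δ Q a D`; the `Δ′_π` step as a letter `G₀Δ′_π = 𝒢∘𝒯₁`, `𝒢 = G₀ ⊕ G₀D`, with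
`𝒯₁ : bC → sup × bP` bounded by `c₁·(Mα₀)·e^{−δ_Td}` ((3.131)); BOUNDS (letters) for `T = tOp : bC → sup` (`C_T`), `R·G′·Dᵀ : sup → bP` (`B₁`),
`G₀ : sup → bC` (`B_G`), `G₀D : bP → bC` (`B′_G`) at `δ_G`, the source entry `G₀F` (`Ae^{−ρ_Sd}`), an a-priori bound `M₀`; FILE 74's regime and
budget for the concrete `Δ⁽²⁾` with box range `R`; rates `0 ≦ ρ ≦ ρ_S`, `ρ + 3σ ≦ δ_T`, `ρ + 2σ ≦ δ_G`; and the LOCATED SMALLNESS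
`Mα₀ ≦ (2D)⁻¹` with `D = κ_C·(max 1 κ_P·(B_G + B′_G)·(c₁ + c₂)·c)·c`, `c₂ = θ₀e^{δ_TR}C_Tc(1 + B₁c)`, `θ₀ = 2dC₃‖τ‖(Σ_i‖e_i‖)M_e c₀·#lv` ⟹ the right
entry `G₁F : b₀ → bC` has the majorant `2A·e^{−ρd}` — «the series (3.138) is convergent for α₀ restricted by a small, absolute constant … the
theorem is valid for G₁». [cite: Balaban1985BackgroundPropagators, (3.138) p.423, Thm 3.12 p.423, (3.135) p.422, (3.137) p.423]
[cite: Balaban1984PropagatorsII, (2.51)–(2.55) p.232, Lemma 2.1 (2.61) p.234] [cite: Balaban1985Averaging, (149) p.40] -/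
theorem thm312_G1_rightEntry_concreteDelta2 (hd : 2 ≤ d) (hJ : ∀ j ∈ lv, j ≤ k) (hw : ∀ j ∈ lv, ∀ c ∈ T j, 0 ≤ w j c)
    {c₀ M Me : ℝ} (hc₀ : 0 ≤ c₀) (hM : 0 ≤ M) (hMe : 0 ≤ Me) (he : ∀ i, ‖e i‖ ≤ Me)
    (hK : ∀ j ∈ lv, ∀ c ∈ T j, w j c * ‖K j c‖ ≤ c₀ * M * α₀ * ((L : ℝ) ^ j) ^ (d - 2))
    {R : ℝ} (hR : ∀ j ∈ lv, ∀ c ∈ T j, ∀ y y' : g.Site, BoxMeets L S blk j c y → BoxMeets L S blk j c y' → g.dist y y' ≤ R)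
    (G1m G0m S1m : Matrix (S × ι) (S × ι) ℝ) (Δ : Matrix n n ℝ) (hΔ : Δ.IsSymm) (Q : Matrix m n ℝ) (a : ℝ) (D : Matrix (S × ι) n ℝ)
    (hfixm : G1m = G0m + G0m * (S1m + B9Delta2Def134.delta2pi (calC L U₀ S lv T w K e τ) Δ Q a D) * G1m)
    {bC : BlockNorm g (S × ι → ℝ)} {bP : BlockNorm g (n → ℝ)} {b₀ : BlockNorm g F₀} {Fop : F₀ →ₗ[ℝ] (S × ι → ℝ)}
    {𝒯₁ : (S × ι → ℝ) →ₗ[ℝ] (S × ι → ℝ) × (n → ℝ)}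
    {c₁ CT B₁ BG BG' A M₀ δT δG ρS ρ σ cr : ℝ}
    (htri : B6RandomWalk.Triangle254 g) (hdist : ∀ y y' : g.Site, 0 ≤ g.dist y y') (hrow : RowSum g σ cr) (hcr : 0 ≤ cr)
    (hc₁ : 0 ≤ c₁) (hCT : 0 ≤ CT) (hB₁ : 0 ≤ B₁) (hBG : 0 ≤ BG) (hBG' : 0 ≤ BG') (hA : 0 ≤ A) (hM₀ : 0 ≤ M₀)
    (hρ : 0 ≤ ρ) (hσ : 0 ≤ σ) (hρS : ρ ≤ ρS) (hρT : ρ + 3 * σ ≤ δT) (hρG : ρ + 2 * σ ≤ δG)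
    (h1 : Matrix.mulVecLin G0m * Matrix.mulVecLin S1m =
      ((Matrix.mulVecLin G0m).coprod (Matrix.mulVecLin (G0m * D))) ∘ₗ 𝒯₁)
    (hT1 : HasMaj bC (prodNorm (BlockNorm.ofBlocks g blk) bP) 𝒯₁ (fun y y' => c₁ * (M * α₀) * Real.exp (-(δT * g.dist y y'))))
    (hT : HasMaj bC (BlockNorm.ofBlocks g blk) (Matrix.mulVecLin (B9SectDFP.tOp Δ Q a D))
      (fun y y' => CT * Real.exp (-(δT * g.dist y y'))))
    (hRG : HasMaj (BlockNorm.ofBlocks g blk) bP (Matrix.mulVecLin (B9H163.R Δ Q a * B9H163.G' Δ Q a * Dᵀ))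
      (fun y y' => B₁ * Real.exp (-(δT * g.dist y y'))))
    (hG0 : HasMaj (BlockNorm.ofBlocks g blk) bC (Matrix.mulVecLin G0m) (fun y y' => BG * Real.exp (-(δG * g.dist y y'))))
    (hG0D : HasMaj bP bC (Matrix.mulVecLin (G0m * D)) (fun y y' => BG' * Real.exp (-(δG * g.dist y y'))))
    (hS : HasMaj b₀ bC (Matrix.mulVecLin G0m ∘ₗ Fop) (fun y y' => A * Real.exp (-(ρS * g.dist y y'))))
    (hap : HasMaj b₀ bC (Matrix.mulVecLin G1m ∘ₗ Fop) (fun _ _ => M₀))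
    (hsm : 0 < bC.κ * (max 1 bP.κ * (BG + BG') * (c₁ +
        (2 * d * C3Gen d L * ‖τ‖ * (∑ i, ‖e i‖) * Me * c₀ * lv.card) * Real.exp (δT * R) * CT * cr * (1 + B₁ * cr)) * cr) * cr →
      M * α₀ ≤ (2 * (bC.κ * (max 1 bP.κ * (BG + BG') * (c₁ +
        (2 * d * C3Gen d L * ‖τ‖ * (∑ i, ‖e i‖) * Me * c₀ * lv.card) * Real.exp (δT * R) * CT * cr * (1 + B₁ * cr)) * cr) * cr))⁻¹) :
    HasMaj b₀ bC (Matrix.mulVecLin G1m ∘ₗ Fop) (fun y y' => 2 * A * Real.exp (-(ρ * g.dist y y'))) := by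
  have hE : 0 ≤ ∑ i, ‖e i‖ := Finset.sum_nonneg fun i _ => norm_nonneg _
  have hC := C3Gen_nonneg d L
  have hc₀M : 0 ≤ c₀ * M := mul_nonneg hc₀ hM
  -- the `Δ⁽²⁾_π` step: §4 with its letters at the rate `δT`, concluded at the rate `δT − 2σ`
  have hT2 := hasMaj_T2_concrete L hL hG k U₀ hU₀ hα hα3 hα4 h52 hb hsmall hc₃ h145 h155 S lv T w K e τ blk hd hJ hw hc₀M hMe he hK hR
    htri hdist hrow hCT hB₁ (show 0 ≤ δT - 2 * σ by linarith) hσ (show δT - 2 * σ + 2 * σ ≤ δT by linarith) hT hRG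
  -- rewrite its constant as `c₂ · (Mα₀)`
  have hT2' : HasMaj bC (prodNorm (BlockNorm.ofBlocks g blk) bP)
      ((Matrix.mulVecLin (B9Delta2Def134.delta2 (calC L U₀ S lv T w K e τ)) ∘ₗ Matrix.mulVecLin (B9SectDFP.tOp Δ Q a D)).prod
        (-(Matrix.mulVecLin (B9H163.R Δ Q a * B9H163.G' Δ Q a * Dᵀ) ∘ₗ
          (Matrix.mulVecLin (B9Delta2Def134.delta2 (calC L U₀ S lv T w K e τ)) ∘ₗ Matrix.mulVecLin (B9SectDFP.tOp Δ Q a D)))))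
      (fun y y' => ((2 * d * C3Gen d L * ‖τ‖ * (∑ i, ‖e i‖) * Me * c₀ * lv.card) * Real.exp (δT * R) * CT * cr * (1 + B₁ * cr)) *
        (M * α₀) * Real.exp (-((δT - 2 * σ) * g.dist y y'))) :=
    hT2.mono fun y y' => le_of_eq (by ring)
  -- both step letters at the common rate `δT' := δT - 2σ` (weaken `𝒯₁`)
  have hc₁m : 0 ≤ c₁ * (M * α₀) := mul_nonneg hc₁ (mul_nonneg hM hα.le)
  have hT1' : HasMaj bC (prodNorm (BlockNorm.ofBlocks g blk) bP) 𝒯₁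
      (fun y y' => c₁ * (M * α₀) * Real.exp (-((δT - 2 * σ) * g.dist y y'))) :=
    hT1.of_rate_le hdist hc₁m (by linarith)
  -- `𝒢 = G₀ ⊕ G₀D`
  have h𝒢 := hasMaj_G (bA := BlockNorm.ofBlocks g blk) hdist hBG hBG' hG0 hG0D
  -- the factored fixed point
  have hfix := fix_of_matrix_fix G1m G0m S1m (B9Delta2Def134.delta2pi (calC L U₀ S lv T w K e τ) Δ Q a D) hfixm
  have h2 := step2_factored G0m (calC L U₀ S lv T w K e τ) Δ Q a D hΔ
  have hθ₀ : 0 ≤ 2 * d * C3Gen d L * ‖τ‖ * (∑ i, ‖e i‖) * Me * c₀ * lv.card :=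
    mul_nonneg (mul_nonneg (mul_nonneg (mul_nonneg (mul_nonneg (mul_nonneg (by positivity) hC) (norm_nonneg _)) hE) hMe) hc₀)
      (Nat.cast_nonneg _)
  have hB₁cr : 0 ≤ 1 + B₁ * cr := add_nonneg zero_le_one (mul_nonneg hB₁ hcr)
  have hc₂ : 0 ≤ (2 * d * C3Gen d L * ‖τ‖ * (∑ i, ‖e i‖) * Me * c₀ * lv.card) * Real.exp (δT * R) * CT * cr * (1 + B₁ * cr) :=
    mul_nonneg (mul_nonneg (mul_nonneg (mul_nonneg hθ₀ (Real.exp_nonneg _)) hCT) hcr) hB₁cr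
  have hκ : (prodNorm (BlockNorm.ofBlocks g blk) bP).κ = max 1 bP.κ := rfl
  refine rightEntry_G1_small (bAP := prodNorm (BlockNorm.ofBlocks g blk) bP) htri hdist hrow hcr hc₁ hc₂ (mul_nonneg hM hα.le)
    (add_nonneg hBG hBG') hA hM₀ hρ hσ hρS (show ρ + σ ≤ δT - 2 * σ by linarith) hρG hfix h1 h2 hT1' hT2' h𝒢 hS hap ?_
  rw [hκ]
  exact hsm

end Assembled

end Literature.MathematicalPhysics.QuantumFieldTheory.Balaban1983to89.B9Eq3138StepDelta2Pi

end
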